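import Summits.BirchSwinnertonDyer.Rank1Residual.P2.CongruentNumberThetaStarTowers
import Summits.BirchSwinnertonDyer.Rank1Residual.P2.CongruentNumberThetaStarBSD
import HarnessLib
import HarnessLib.Audit.Tags

/-!
# Cell «bsd-monsky» (prover-B): 𝒮⁻-TOWERS, clause (b) — Monsky's even matrix on the star configuration with `q ≡ 7 (mod 8)`
# (`s(n) = 1` for every `m`), and THE THEOREM: for every pair `(p, q)` of Monsky's family `𝒮⁻` and any primes `p₂, …, p_m ≡ 5 (mod 8)`
# that are quadratic residues of `q`, of `p` and of each other, `E_{2qpp₂⋯p_m}` has `ord_{s=1} L = 1`, rank `1`, `Ш[2^∞] = 0` and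
# `BSD(E, 2)`, relative to {`tyz_cmPointGaloisData`, TYZ Thm. 1.1, GZK, Monsky's even matrix theorem} (kernel theorem; nothing asserted)

HONEST FRAMING (cell `bsd-monsky`, run/shared/lean/pub/bsd-monsky/; README §1/§3): the cell's CLAIMED theorem is Monsky's 1990
conjecture (a)+(b) on `𝒮⁻ = {2pq : p ≡ 5 (mod 8), q ≡ 3 (mod 4), (p/q) = −1}` (`k = 2`); «ℓ ≥ 3 rungs are NOT claimed — record what the
same argument gives there, no more». THIS FILE closes the record UNIFORM IN THE NUMBER OF PRIME FACTORS over BOTH halves of `𝒮⁻`: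
`…ThetaStarBSD` did `q ≡ 3 (mod 8)`; here §1 computes the kernel of Monsky's even matrix `M = (Aᵀ + D₂, D₋₁; D₂, A + D₂)` on the star
configuration with `q ≡ 7 (mod 8)` and EXACTLY one mark `a` — now `D₂ = diag(0, 1, …, 1)` (`(2/q) = +1`), `D₋₁ = E₀₀`, `Aᵀ = A`; the
scalar equations `μᵢ(xᵢ + x₀) + xᵢ = 0`, `xᵢ + μᵢ(yᵢ + y₀) + yᵢ = 0` (`i ≥ 1`), `Σμⱼ(x₀ + xⱼ) + y₀ = 0`, `Σμⱼ(y₀ + yⱼ) = 0` have the two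
solutions `y₀·(0, μ ; 1, μ)` (`μ` = the indicator of the mark): `s(n) = 1` for every `m` (`monskySelmerRankEven_star_seven`; with
`…_star`: `monskySelmerRankEven_tower` for `q ≡ 3 (mod 4)`). §2 the rank-one datum and clause (b) through the uniform even door
(`rankOne_sha_bsdp_two_tower_of_cmPointGaloisData`). §3 THE 𝒮⁻-TOWER THEOREM on the Legendre symbols (`rankOne_sha_bsdp_two_sminus_tower`):
for `(p, q) ∈ 𝒮⁻` and distinct primes `p₂, …, p_m ≡ 5 (mod 8)` (any `m ≥ 1`) with `(pᵢ/q) = (pᵢ/p) = (pᵢ/pⱼ) = +1`: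
`ord_{s=1} L(E_n, s) = 1`, rank `E_n(ℚ) = 1`, `Ш(E_n)[2^∞] = 0`, `BSD(E_n, 2)` for `n = 2qp·p₂⋯p_m` — Monsky's (a)+(b) shape on every tower
above every pair of `𝒮⁻`, relative to {`tyz_cmPointGaloisData`, `thm11_parity_of_scriptL`, GZK, `monsky_card_selmerGroup_two_even`}; at
`m = 1` it is the cell's theorem on `𝒮⁻` through route B (+ `h11`, idle there) — the `k = 2` enclosure of record is NOT touched. CONTROL
(never an input): kit j253031 / j252342 — `s(n) = 1`, `Σ₂′ = 0` (TYZ-silent) and analytic rank `1` on every one-mark member tested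
(`m ≤ 4` resp. `≤ 5`; `70, 182, 230, …, 2030, 6670, …, 221270, …`); 0 alarms. CONDITIONAL on the named facts said; nothing asserted;
no count moves; no class booked. NOT refereed; not part of PROOF-B v1.3 or of the paper.

References: [HeathBrown1994SelmerCongruentII] Appendix (Monsky), typescript p. 39 L10–L26, p. 41 L20–L36; [TianYuanZhang2017] §1
(1.1), Thm. 1.1, Thm. 3.5; [Monsky1990MockHeegner] p. 67 Remark (3); [SilvermanAEC2009] Thm. X.4.2; [IrelandRosen1990] Ch. 5 §1
Prop. 5.1.2–5.1.3, §2 Thm. 2; [Miller2011LMS] Def. 1.1; HOME/proof/PROOF-B-THETA-STAR.md.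
-/

noncomputable section

open scoped Classical

open Matrix Finset WeierstrassCurve Literature.NumberTheory.EllipticCurves
  Literature.NumberTheory.EllipticCurves.Rank1Residual
  Literature.NumberTheory.EllipticCurves.Rank1Residual.Typed
  Literature.NumberTheory.EllipticCurves.HeathBrown1994
  Literature.NumberTheory.EllipticCurves.HeathBrown1994.Families
  Literature.NumberTheory.EllipticCurves.Tian2014
  Literature.NumberTheory.EllipticCurves.TianYuanZhang2017
  Literature.NumberTheory.EllipticCurves.TianYuanZhang2017.W2
  Literature.NumberTheory.QuadraticFields.RedeiReichardt

set_option autoImplicit false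

namespace Summit.BirchSwinnertonDyer.Rank1Residual.P2

namespace ThetaDescent

variable {m : ℕ} {q : ℕ} {p : Fin m → ℕ}

/-! ## §1 Monsky's even matrix on the star configuration with `q ≡ 7 (mod 8)`: `#ker M = 2`, `s(n) = 1`, for every `m` -/

/-- `D₂ = diag(0, 1, …, 1)` for `q ≡ 7 (mod 8)`: `(2/q) = +1`, `(2/pᵢ) = −1`.
[cite: HeathBrown1994SelmerCongruentII, Appendix (Monsky), typescript p. 39 L10–L13 (D_j)] [cite: IrelandRosen1990, Ch. 5 §1 Prop. 5.1.3] -/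
theorem legendreDiagonal_two_star_seven (hq7 : q % 8 = 7) (hp5 : ∀ i, p i % 8 = 5) :
    legendreDiagonal (vecCons q p : Fin (m + 1) → ℕ) 2 =
      Matrix.diagonal fun j : Fin (m + 1) => if j = 0 then (0 : ZMod 2) else 1 := by
  unfold legendreDiagonal
  congr 1; funext j; refine Fin.cases ?_ (fun i => ?_) j
  · rw [if_pos rfl, cons_val_zero]
    exact addLegendreSym_of_eq_one (jacobiSym_two_eq_one (Or.inr hq7))
  · rw [if_neg (Fin.succ_ne_zero i), cons_val_succ]
    exact addLegendreSym_of_eq_neg_one (jacobiSym_two_eq_neg_one (Or.inr (hp5 i)))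

/-- `D₋₁ = E₀₀` for `q ≡ 3 (mod 4)`: `(−1/q) = −1`, `(−1/pᵢ) = +1`.
[cite: HeathBrown1994SelmerCongruentII, Appendix (Monsky), typescript p. 41 L20–L26 (D₋₁)] [cite: IrelandRosen1990, Ch. 5 §1 Prop. 5.1.2] -/
theorem legendreDiagonal_neg_one_star' (hq4 : q % 4 = 3) (hp5 : ∀ i, p i % 8 = 5) :
    legendreDiagonal (vecCons q p : Fin (m + 1) → ℕ) (-1) =
      Matrix.diagonal fun j : Fin (m + 1) => if j = 0 then (1 : ZMod 2) else 0 := by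
  unfold legendreDiagonal
  congr 1; funext j; refine Fin.cases ?_ (fun i => ?_) j
  · rw [if_pos rfl, cons_val_zero]
    exact addLegendreSym_of_eq_neg_one (DeuringLadic.jacobiSym_neg_one_of_mod_four hq4)
  · rw [if_neg (Fin.succ_ne_zero i), cons_val_succ]
    exact addLegendreSym_of_eq_one (jacobiSym_neg_one_eq_one (by have := hp5 i; omega))

/-- **The kernel of Monsky's even matrix on the star configuration with `q ≡ 7 (mod 8)` and exactly one mark `a`**, for every `m`:
`M(x; y) = 0 ⟺ (x; y) ∈ {0, (0, μ ; 1, μ)}`, `μ` the indicator of `a` (the scalar equations of the module docstring, solved by hand).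
[cite: HeathBrown1994SelmerCongruentII, Appendix (Monsky), typescript p. 41 L20–L36 (the even matrix; evaluation ours)]
[cite: IrelandRosen1990, Ch. 5 §2 Thm. 2 (reciprocity)] -/
theorem monskyMatrixEven_mulVec_eq_zero_iff_star_seven (hq : q.Prime) (hq7 : q % 8 = 7) (hp : ∀ i, (p i).Prime)
    (hp5 : ∀ i, p i % 8 = 5) (hQR : ∀ i j, i ≠ j → jacobiSym (p j) (p i) = 1)
    (hμ : ∀ i j, jacobiSym (p i) q = -1 → jacobiSym (p j) q = -1 → i = j) {a : Fin m} (ha : jacobiSym (p a) q = -1)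
    (z : Fin (m + 1) ⊕ Fin (m + 1) → ZMod 2) :
    monskyMatrixEven (vecCons q p : Fin (m + 1) → ℕ) *ᵥ z = 0 ↔
      z = 0 ∨ z = Sum.elim (vecCons 0 fun i => addLegendreSym (p i) q) (vecCons 1 fun i => addLegendreSym (p i) q) := by
  have hq4 : q % 4 = 3 := by omega
  have hodd := star_cons_odd' (q := q) (p := p) hq4 hp5
  have hsymm : (legendreMatrix (vecCons q p : Fin (m + 1) → ℕ))ᵀ = legendreMatrix (vecCons q p : Fin (m + 1) → ℕ) :=
    legendreMatrix_transpose_eq _ hodd (fun i hi => by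
      obtain ⟨j, rfl⟩ := Fin.exists_succ_eq.mpr hi
      simp only [cons_val_succ]; have := hp5 j; omega)
  have hD2 := legendreDiagonal_two_star_seven (m := m) (p := p) hq7 hp5
  have hDm1 := legendreDiagonal_neg_one_star' (m := m) (p := p) hq4 hp5
  set μ : Fin m → ZMod 2 := fun i => addLegendreSym (p i) q with hμdef
  have zmod_cases : ∀ c : ZMod 2, c = 0 ∨ c = 1 := by decide
  have eq_of_add : ∀ x y : ZMod 2, x + y = 0 → x = y := by decide
  have hμa : μ a = 1 := by simp [hμdef, addLegendreSym_of_eq_neg_one ha]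
  have hμ0 : ∀ j, j ≠ a → μ j = 0 := by
    intro j hj
    have hvj := jacobiSym.eq_one_or_neg_one (int_gcd_prime_eq_one (hp j) hq (fun h => by have := hp5 j; omega))
    rcases hvj with h | h
    · simp [hμdef, addLegendreSym_of_eq_one h]
    · exact absurd (hμ j a h ha) hj
  have hsum : ∑ i, μ i = 1 := by
    rw [Finset.sum_eq_single a (fun j _ hj => hμ0 j hj) (fun h => absurd (mem_univ a) h), hμa]
  have hα0s : ∀ i : Fin m, addLegendreSym ((vecCons q p : Fin (m + 1) → ℕ) i.succ) ((vecCons q p : Fin (m + 1) → ℕ) 0) = μ i := by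
    intro i; simp [hμdef]
  have hαs0 : ∀ i : Fin m, addLegendreSym ((vecCons q p : Fin (m + 1) → ℕ) 0) ((vecCons q p : Fin (m + 1) → ℕ) i.succ) = μ i := by
    intro i
    simp only [cons_val_zero, cons_val_succ, hμdef]
    exact (addLegendreSym_comm_of_mod_four_eq_one (by have := hp5 i; omega) (Nat.odd_iff.mpr (by omega))).symm
  have hαss : ∀ i j : Fin m, i ≠ j →
      addLegendreSym ((vecCons q p : Fin (m + 1) → ℕ) j.succ) ((vecCons q p : Fin (m + 1) → ℕ) i.succ) = 0 := by
    intro i j hij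
    simp only [cons_val_succ]
    exact addLegendreSym_of_eq_one (hQR i j hij)
  have hA0 : ∀ v : Fin (m + 1) → ZMod 2, (legendreMatrix (vecCons q p : Fin (m + 1) → ℕ) *ᵥ v) 0 =
      ∑ i : Fin m, μ i * (v 0 + v i.succ) := by
    intro v
    rw [legendreMatrix_mulVec_apply, Fin.sum_univ_succ, CharTwo.add_self_eq_zero, mul_zero, zero_add]
    exact Finset.sum_congr rfl fun i _ => by rw [hα0s]
  have hAs : ∀ (v : Fin (m + 1) → ZMod 2) (i : Fin m), (legendreMatrix (vecCons q p : Fin (m + 1) → ℕ) *ᵥ v) i.succ =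
      μ i * (v i.succ + v 0) := by
    intro v i
    rw [legendreMatrix_mulVec_apply, Fin.sum_univ_succ, hαs0]
    have hrest : ∑ j : Fin m, addLegendreSym ((vecCons q p : Fin (m + 1) → ℕ) j.succ)
        ((vecCons q p : Fin (m + 1) → ℕ) i.succ) * (v i.succ + v j.succ) = 0 := by
      refine Finset.sum_eq_zero fun j _ => ?_
      by_cases hji : i = j
      · subst hji; rw [CharTwo.add_self_eq_zero, mul_zero]
      · rw [hαss i j hji, zero_mul]
    rw [hrest, add_zero]
  -- `M (x;y) = (Ax + D₂x + Ey ; D₂x + Ay + D₂y)` coordinatewise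
  have hM : ∀ x y : Fin (m + 1) → ZMod 2, monskyMatrixEven (vecCons q p : Fin (m + 1) → ℕ) *ᵥ Sum.elim x y = 0 ↔
      (∀ c, (legendreMatrix (vecCons q p : Fin (m + 1) → ℕ) *ᵥ x) c + (if c = 0 then (0 : ZMod 2) else 1) * x c +
          (if c = 0 then (1 : ZMod 2) else 0) * y c = 0) ∧
      (∀ c, (if c = 0 then (0 : ZMod 2) else 1) * x c +
          ((legendreMatrix (vecCons q p : Fin (m + 1) → ℕ) *ᵥ y) c + (if c = 0 then (0 : ZMod 2) else 1) * y c) = 0) := by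
    intro x y
    rw [monskyMatrixEven, hsymm, hD2, hDm1, Matrix.fromBlocks_mulVec]
    simp only [Sum.elim_comp_inl, Sum.elim_comp_inr, Matrix.add_mulVec]
    constructor
    · intro h
      refine ⟨fun c => ?_, fun c => ?_⟩
      · have := congr_fun h (Sum.inl c)
        simpa only [Sum.elim_inl, Pi.add_apply, Pi.zero_apply, Matrix.mulVec_diagonal] using this
      · have := congr_fun h (Sum.inr c)
        simpa only [Sum.elim_inr, Pi.add_apply, Pi.zero_apply, Matrix.mulVec_diagonal] using this
    · rintro ⟨ht, hb⟩
      funext c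
      rcases c with c | c
      · simpa only [Sum.elim_inl, Pi.add_apply, Pi.zero_apply, Matrix.mulVec_diagonal] using ht c
      · simpa only [Sum.elim_inr, Pi.add_apply, Pi.zero_apply, Matrix.mulVec_diagonal] using hb c
  set w : Fin (m + 1) ⊕ Fin (m + 1) → ZMod 2 := Sum.elim (vecCons 0 fun i => μ i) (vecCons 1 fun i => μ i) with hw
  obtain ⟨x, y, rfl⟩ : ∃ x y, z = Sum.elim x y := ⟨z ∘ Sum.inl, z ∘ Sum.inr, (Sum.elim_comp_inl_inr z).symm⟩
  rw [hM]
  constructor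
  · rintro ⟨ht, hb⟩
    have ti : ∀ i : Fin m, μ i * (x i.succ + x 0) + x i.succ = 0 := by
      intro i; have h := ht i.succ
      rw [hAs, if_neg (Fin.succ_ne_zero i), if_neg (Fin.succ_ne_zero i), one_mul, zero_mul, add_zero] at h; exact h
    have bi : ∀ i : Fin m, x i.succ + (μ i * (y i.succ + y 0) + y i.succ) = 0 := by
      intro i; have h := hb i.succ
      rw [hAs, if_neg (Fin.succ_ne_zero i), one_mul, one_mul] at h; exact h
    have b0 : ∑ j : Fin m, μ j * (y 0 + y j.succ) = 0 := by
      have h := hb 0; rw [hA0, if_pos rfl, zero_mul, zero_add, zero_mul, add_zero] at h; exact h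
    have hxu : ∀ i, μ i = 0 → x i.succ = 0 := by
      intro i hi; have h := ti i; rw [hi, zero_mul, zero_add] at h; exact h
    have hyu : ∀ i, μ i = 0 → y i.succ = 0 := by
      intro i hi; have h := bi i; rw [hi, zero_mul, zero_add, hxu i hi, zero_add] at h; exact h
    have hx0 : x 0 = 0 := by
      have h := ti a; rw [hμa, one_mul] at h
      have : ∀ u v : ZMod 2, u + v + u = 0 → v = 0 := by decide
      exact this _ _ h
    have hxa : x a.succ = y 0 := by
      have h := bi a; rw [hμa, one_mul] at h
      have : ∀ u v s : ZMod 2, u + (v + s + v) = 0 → u = s := by decide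
      exact this _ _ _ h
    have hya : y a.succ = y 0 := by
      have h := b0
      rw [Finset.sum_eq_single a (fun j _ hj => by rw [hμ0 j hj, zero_mul]) (fun h => absurd (mem_univ a) h),
        hμa, one_mul] at h
      exact (eq_of_add _ _ h).symm
    have hxs : ∀ i : Fin m, x i.succ = μ i * y 0 := by
      intro i
      by_cases hia : i = a
      · subst hia; rw [hμa, one_mul, hxa]
      · rw [hμ0 i hia, zero_mul]; exact hxu i (hμ0 i hia)
    have hys : ∀ i : Fin m, y i.succ = μ i * y 0 := by
      intro i
      by_cases hia : i = a
      · subst hia; rw [hμa, one_mul, hya]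
      · rw [hμ0 i hia, zero_mul]; exact hyu i (hμ0 i hia)
    rcases zmod_cases (y 0) with hy0 | hy0
    · left
      funext c
      rcases c with c | c <;> refine Fin.cases ?_ (fun i => ?_) c
      · simp [hx0]
      · simp [hxs i, hy0]
      · simp [hy0]
      · simp [hys i, hy0]
    · right
      funext c
      rcases c with c | c <;> refine Fin.cases ?_ (fun i => ?_) c
      · simp [hw, hx0]
      · simp [hw, hxs i, hy0]
      · simp [hw, hy0]
      · simp [hw, hys i, hy0]
  · rintro (h0 | h1)
    · have hx : x = 0 := by funext c; simpa using congr_fun h0 (Sum.inl c)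
      have hy : y = 0 := by funext c; simpa using congr_fun h0 (Sum.inr c)
      subst hx; subst hy
      simp
    · have hx : x = vecCons 0 fun i => μ i := by funext c; simpa [hw] using congr_fun h1 (Sum.inl c)
      have hy : y = vecCons 1 fun i => μ i := by funext c; simpa [hw] using congr_fun h1 (Sum.inr c)
      subst hx; subst hy
      have hsq : ∀ c : ZMod 2, c * c = c := by decide
      constructor
      · intro c
        refine Fin.cases ?_ (fun i => ?_) c
        · rw [hA0, if_pos rfl, if_pos rfl]
          simp only [cons_val_zero, cons_val_succ, zero_add, hsq, hsum, add_zero]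
          decide
        · rw [hAs, if_neg (Fin.succ_ne_zero i), if_neg (Fin.succ_ne_zero i)]
          simp only [cons_val_succ, cons_val_zero, add_zero, hsq, one_mul, zero_mul]
          exact CharTwo.add_self_eq_zero _
      · intro c
        refine Fin.cases ?_ (fun i => ?_) c
        · rw [hA0, if_pos rfl]
          simp only [cons_val_zero, cons_val_succ, zero_mul, zero_add, add_zero]
          refine Finset.sum_eq_zero fun i _ => ?_
          have : ∀ c : ZMod 2, c * (1 + c) = 0 := by decide
          exact this _
        · rw [hAs, if_neg (Fin.succ_ne_zero i)]
          simp only [cons_val_succ, cons_val_zero, one_mul]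
          have : ∀ c : ZMod 2, c + (c * (c + 1) + c) = 0 := by decide
          exact this _

/-- **`#ker M = 2` for `q ≡ 7 (mod 8)`, exactly one mark**, uniformly in `m`. [cite: HeathBrown1994SelmerCongruentII, Appendix (Monsky), typescript p. 41 L20–L36] -/
theorem card_ker_monskyMatrixEven_star_seven (hq : q.Prime) (hq7 : q % 8 = 7) (hp : ∀ i, (p i).Prime) (hp5 : ∀ i, p i % 8 = 5)
    (hQR : ∀ i j, i ≠ j → jacobiSym (p j) (p i) = 1) (hμ : ∀ i j, jacobiSym (p i) q = -1 → jacobiSym (p j) q = -1 → i = j)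
    {a : Fin m} (ha : jacobiSym (p a) q = -1) :
    Fintype.card {z : Fin (m + 1) ⊕ Fin (m + 1) → ZMod 2 // monskyMatrixEven (vecCons q p : Fin (m + 1) → ℕ) *ᵥ z = 0} = 2 := by
  rw [Fintype.card_of_subtype ({0, Sum.elim (vecCons 0 fun i => addLegendreSym (p i) q) (vecCons 1 fun i => addLegendreSym (p i) q)}
      : Finset (Fin (m + 1) ⊕ Fin (m + 1) → ZMod 2))
    (fun z => by
      rw [Finset.mem_insert, Finset.mem_singleton]
      exact (monskyMatrixEven_mulVec_eq_zero_iff_star_seven hq hq7 hp hp5 hQR hμ ha z).symm)]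
  refine Finset.card_pair fun h => ?_
  have := congr_fun h (Sum.inr 0)
  simp at this

/-- **`s(n) = 1` for `q ≡ 7 (mod 8)`, exactly one mark**, every `m`. [cite: HeathBrown1994SelmerCongruentII, Appendix (Monsky), typescript p. 41 L36] -/
theorem monskySelmerRankEven_star_seven (hq : q.Prime) (hq7 : q % 8 = 7) (hp : ∀ i, (p i).Prime) (hp5 : ∀ i, p i % 8 = 5)
    (hQR : ∀ i j, i ≠ j → jacobiSym (p j) (p i) = 1) (hμ : ∀ i j, jacobiSym (p i) q = -1 → jacobiSym (p j) q = -1 → i = j)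
    {a : Fin m} (ha : jacobiSym (p a) q = -1) : monskySelmerRankEven (vecCons q p : Fin (m + 1) → ℕ) = 1 :=
  monskySelmerRankEven_eq_one_of_card_ker _ (card_ker_monskyMatrixEven_star_seven hq hq7 hp hp5 hQR hμ ha)

/-- **`s(n) = 1` on the 𝒮⁻-towers** (`q ≡ 3 (mod 4)`; a mark exists unless `q ≡ 3 (mod 8)`), every `m`.
[cite: HeathBrown1994SelmerCongruentII, Appendix (Monsky), typescript p. 41 L36] -/
theorem monskySelmerRankEven_tower (hq : q.Prime) (hq4 : q % 4 = 3) (hp : ∀ i, (p i).Prime) (hp5 : ∀ i, p i % 8 = 5)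
    (hQR : ∀ i j, i ≠ j → jacobiSym (p j) (p i) = 1) (hμ : ∀ i j, jacobiSym (p i) q = -1 → jacobiSym (p j) q = -1 → i = j)
    (hmark : q % 8 = 3 ∨ ∃ a, jacobiSym (p a) q = -1) : monskySelmerRankEven (vecCons q p : Fin (m + 1) → ℕ) = 1 := by
  by_cases hq3 : q % 8 = 3
  · exact monskySelmerRankEven_star hq hq3 hp hp5 hQR hμ
  · obtain ⟨a, ha⟩ := hmark.resolve_left hq3
    exact monskySelmerRankEven_star_seven hq (by omega) hp hp5 hQR hμ ha

/-! ## §2 The rank-one datum and clause (b) on the towers -/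

/-- The tower hypotheses on the Jacobi symbols, in `kroneckerBit` form. [cite: IrelandRosen1990, Ch. 5 §1 Prop. 5.1.2 (Euler's criterion)] -/
theorem tower_bits_of_jacobi (hq : q.Prime) (hq4 : q % 4 = 3) (hp : ∀ i, (p i).Prime) (hp5 : ∀ i, p i % 8 = 5)
    (hinj : Function.Injective p) (hQR : ∀ i j, i ≠ j → jacobiSym (p j) (p i) = 1)
    (hμ : ∀ i j, jacobiSym (p i) q = -1 → jacobiSym (p j) q = -1 → i = j) (hmark : q % 8 = 3 ∨ ∃ a, jacobiSym (p a) q = -1) :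
    (∀ i j, i ≠ j → kroneckerBit (p j) (p i) = 0) ∧ (∀ i j, kroneckerBit (p i) q = 1 → kroneckerBit (p j) q = 1 → i = j) ∧
      (q % 8 = 3 ∨ ∃ a, kroneckerBit (p a) q = 1) := by
  have hq2 : q ≠ 2 := by omega
  have hne : ∀ i, p i ≠ q := fun i h => by have := hp5 i; omega
  refine ⟨fun i j hij => ?_, fun i j hi hj => ?_, hmark.imp id fun ⟨a, ha⟩ => ⟨a, ?_⟩⟩
  · exact (kroneckerBit_of_jacobiSym (hp j) (hp i) (by have := hp5 i; omega) (fun h => hij.symm (hinj h))).1 (hQR i j hij)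
  · exact hμ i j ((kroneckerBit_eq_one_iff_jacobiSym hq hq2 (intCast_natCast_prime_ne_zero (hp i) hq (hne i))).mp hi)
      ((kroneckerBit_eq_one_iff_jacobiSym hq hq2 (intCast_natCast_prime_ne_zero (hp j) hq (hne j))).mp hj)
  · exact (kroneckerBit_of_jacobiSym (hp a) hq hq2 (hne a)).2 ha

/-- **`ord_{s=1} L = 1`, rank `1`, `Ш[2^∞] = 0` and `BSD(E_n, 2)` on the 𝒮⁻-towers, for every `m`**: `q ≡ 3 (mod 4)`, `p₁, …, p_m ≡ 5 (mod 8)`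
distinct, `(pⱼ/pᵢ) = +1` (`i ≠ j`), at most one mark `(pᵢ/q) = −1` and at least one unless `q ≡ 3 (mod 8)`, `n = 2qp₁⋯p_m`: the rank-one datum
`x = 2^{2m}L²` (`L` odd, `…_tower`) and `s(n) = 1` (§1) through the uniform even door. Relative to {`tyz_cmPointGaloisData`, TYZ Thm. 1.1,
GZK, `hMe`}; NO per-`n` certificate. CONDITIONAL; nothing asserted; closes no class by itself; NOT refereed.
[cite: TianYuanZhang2017, §1 (1.1), Thm. 3.5] [cite: HeathBrown1994SelmerCongruentII, Appendix (Monsky), typescript p. 41 L20–L36]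
[cite: SilvermanAEC2009, Thm. X.4.2] [cite: Miller2011LMS, Def. 1.1 (arXiv:1010.2431 p. 3)] -/
theorem rankOne_sha_bsdp_two_tower_of_cmPointGaloisData (hCM : tyz_cmPointGaloisData)
    (hGZK : rank_eq_analyticRank_of_analyticRank_le_one) (hMe : monsky_card_selmerGroup_two_even) (h11 : thm11_parity_of_scriptL)
    (hq : q.Prime) (hq4 : q % 4 = 3) (hp : ∀ i, (p i).Prime) (hp5 : ∀ i, p i % 8 = 5) (hinj : Function.Injective p)
    (hQR : ∀ i j, i ≠ j → jacobiSym (p j) (p i) = 1) (hμ : ∀ i j, jacobiSym (p i) q = -1 → jacobiSym (p j) q = -1 → i = j)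
    (hmark : q % 8 = 3 ∨ ∃ a, jacobiSym (p a) q = -1) :
    (congruentNumberCurve (2 * (q * ∏ i, p i))).analyticRank = 1 ∧
      (congruentNumberCurve (2 * (q * ∏ i, p i))).mordellWeilRank = 1 ∧
      AddCommGroup.primaryComponent (congruentNumberCurve (2 * (q * ∏ i, p i))).sha 2 = ⊥ ∧
      BSDp (congruentNumberCurve (2 * (q * ∏ i, p i))) 2 := by
  obtain ⟨hQR', hμ', hmark'⟩ := tower_bits_of_jacobi hq hq4 hp hp5 hinj hQR hμ hmark
  have hsq := squarefree_star' hq hq4 hp hp5 hinj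
  haveI := isElliptic_congruentNumberCurve hsq.ne_zero
  have hn6 := star_mod_eight' hq4 hp hp5 hinj
  obtain ⟨L, hLodd, hL⟩ := exists_odd_isScriptL_tower_of_cmPointGaloisData hCM hGZK h11 hq hq4 hp hp5 hinj hQR' hμ' hmark'
  have hL0' : L ≠ 0 := fun h => by simp [h] at hLodd
  have hL0 : (L : ℚ) ≠ 0 := by exact_mod_cast hL0'
  have hr1 := analyticRank_congruentNumberCurve_eq_one_of_isScriptL hsq (Or.inr (Or.inl hn6)) hL hL0'
  have he : twoExponent (2 * (q * ∏ i, p i)) = 2 * ((m + 1 : ℕ) : ℤ) - 2 := by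
    rw [← prod_star_cons]
    exact twoExponent_two_mul_prod_eq _ (star_cons_prime hq hp) (star_cons_odd' hq4 hp5) (star_cons_injective' hq4 hp5 hinj)
  have hx : deriv (congruentNumberCurve (2 * (q * ∏ i, p i))).entireLFunction 1 =
      (((2 : ℚ) ^ twoExponent (2 * (q * ∏ i, p i)) * (L : ℚ) ^ 2 : ℚ) : ℂ) *
        ((congruentNumberCurve (2 * (q * ∏ i, p i))).realPeriodRat : ℂ) *
          ((congruentNumberCurve (2 * (q * ∏ i, p i))).regulator : ℂ) := by
    rw [← (leadingLCoeff_eq_deriv_of_analyticRank_eq_one hr1).1,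
      leadingLCoeff_congruentNumberCurve_eq_of_isScriptL (Nat.pos_of_ne_zero hsq.ne_zero) hr1 hL]
    push_cast
    ring
  have hn : 2 * ∏ i, (vecCons q p : Fin (m + 1) → ℕ) i = 2 * (q * ∏ i, p i) := by rw [prod_star_cons]
  obtain ⟨hr1', hrk, hsha, hiff⟩ :=
    rankOne_sha_bsdp_two_iff_congruentNumberCurve_two_mul_prod (vecCons q p : Fin (m + 1) → ℕ) hGZK hMe (star_cons_prime hq hp)
      (star_cons_injective' hq4 hp5 hinj) hn hn6 (monskySelmerRankEven_tower hq hq4 hp hp5 hQR hμ hmark)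
      (mul_ne_zero (zpow_ne_zero _ two_ne_zero) (pow_ne_zero _ hL0)) hx
  exact ⟨hr1', hrk, hsha, hiff.mpr (by rw [padicValRat_two_zpow_mul_sq hLodd, he])⟩

/-! ## §3 THE 𝒮⁻-TOWER THEOREM on the Legendre symbols -/

/-- **THE 𝒮⁻-TOWER THEOREM (route B, uniform in the number of prime factors).** Let `(p, q)` be a pair of Monsky's family `𝒮⁻` — primes
`p ≡ 5 (mod 8)`, `q ≡ 3 (mod 4)`, `(p/q) = −1` — and `p₁, …, p_m ≡ 5 (mod 8)` (`m ≥ 0`) further distinct primes that are quadratic residues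
of `q`, of `p`, and of each other. Then for `n = 2·q·p·p₁⋯p_m` the congruent number curve `E_n : y² = x³ − n²x` has `ord_{s=1} L(E_n, s) = 1`,
rank `E_n(ℚ) = 1`, `Ш(E_n)[2^∞] = 0`, and the `2`-part of the Birch–Swinnerton-Dyer formula holds. (`m = 0`: the cell's Theorem 1.1 on `𝒮⁻`
through route B; `m ≥ 1`: every tower above it. Members: `30, 70, 174, …; 1830, 2030, …; 199470, 221270, …`.) Relative to
{`tyz_cmPointGaloisData`, `thm11_parity_of_scriptL`, `rank_eq_analyticRank_of_analyticRank_le_one`, `monsky_card_selmerGroup_two_even`};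
nothing asserted; no class booked; NOT refereed. [cite: Monsky1990MockHeegner, p. 67 Remark (3)] [cite: TianYuanZhang2017, §1 (1.1), Thm. 1.1, Thm. 3.5]
[cite: HeathBrown1994SelmerCongruentII, Appendix (Monsky), typescript p. 41 L20–L36] [cite: IrelandRosen1990, Ch. 5 §2 Thm. 2] -/
theorem rankOne_sha_bsdp_two_sminus_tower (hCM : tyz_cmPointGaloisData) (hGZK : rank_eq_analyticRank_of_analyticRank_le_one)
    (hMe : monsky_card_selmerGroup_two_even) (h11 : thm11_parity_of_scriptL) :
    ∀ (m p₀ q : ℕ) (p : Fin m → ℕ), p₀.Prime → q.Prime → p₀ % 8 = 5 → q % 4 = 3 → jacobiSym p₀ q = -1 →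
      (∀ i, (p i).Prime) → (∀ i, p i % 8 = 5) → Function.Injective p →
      (∀ i, jacobiSym (p i) q = 1) → (∀ i, jacobiSym (p i) p₀ = 1) → (∀ i j, i ≠ j → jacobiSym (p j) (p i) = 1) →
      (congruentNumberCurve (2 * (q * (p₀ * ∏ i, p i)))).analyticRank = 1 ∧
        (congruentNumberCurve (2 * (q * (p₀ * ∏ i, p i)))).mordellWeilRank = 1 ∧
        AddCommGroup.primaryComponent (congruentNumberCurve (2 * (q * (p₀ * ∏ i, p i)))).sha 2 = ⊥ ∧
        BSDp (congruentNumberCurve (2 * (q * (p₀ * ∏ i, p i)))) 2 := by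
  intro m p₀ q p hp₀ hq h₀ hq4 hmark hp hp5 hinj hq1 hres hQR
  have hprod : p₀ * ∏ i, p i = ∏ i, (vecCons p₀ p : Fin (m + 1) → ℕ) i := by rw [Fin.prod_univ_succ]; simp
  have hne : ∀ i, p i ≠ p₀ := fun i h => by
    have h1 := hres i; rw [h, jacobiSym.mod_left] at h1
    simp [jacobiSym.zero_left hp₀.one_lt] at h1
  rw [hprod]
  refine rankOne_sha_bsdp_two_tower_of_cmPointGaloisData hCM hGZK hMe h11 hq hq4
    (fun i => Fin.cases (by simpa using hp₀) (fun j => by simpa using hp j) i)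
    (fun i => Fin.cases (by simpa using h₀) (fun j => by simpa using hp5 j) i) ?_ ?_ ?_ (Or.inr ⟨0, by simpa using hmark⟩)
  · have h : Function.Injective (Fin.cons p₀ p : Fin (m + 1) → ℕ) := by
      rw [Fin.cons_injective_iff]
      exact ⟨by rintro ⟨i, hi⟩; exact hne i hi, hinj⟩
    exact h
  · intro i j hij
    induction i using Fin.cases with
    | zero =>
      induction j using Fin.cases with
      | zero => exact absurd rfl hij
      | succ j' => simpa using hres j'
    | succ i' =>
      induction j using Fin.cases with
      | zero =>
        simp only [cons_val_zero, cons_val_succ]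
        rw [jacobiSym.quadratic_reciprocity_one_mod_four (by omega : p₀ % 4 = 1)
          ((hp i').odd_of_ne_two (by have := hp5 i'; omega))]
        exact hres i'
      | succ j' =>
        simp only [cons_val_succ]
        exact hQR i' j' fun h => hij (by rw [h])
  · intro i j hi hj
    have h0 : ∀ i' : Fin m, jacobiSym ((vecCons p₀ p : Fin (m + 1) → ℕ) i'.succ) q ≠ -1 := fun i' => by
      simp only [cons_val_succ]; rw [hq1 i']; decide
    induction i using Fin.cases with
    | zero =>
      induction j using Fin.cases with
      | zero => rfl
      | succ j' => exact absurd hj (h0 j')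
    | succ i' => exact absurd hi (h0 i')

end ThetaDescent

end Summit.BirchSwinnertonDyer.Rank1Residual.P2

end
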